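import Summits.QuantumFields.YangMills.Theorems.BalabanUVNodesK2CornerRoadRowsMassBand

/-!
# Apply check (crux workfile, NOT a Theorems file), EDITION 2: by-name interoperability of `…Theorems.BalabanUVNodesK2CornerRoadRows` (p621195) and `…K2CornerRoadRowsMassBand` (p622247) with p613914 / p616926 / p617892 / p620073

Importing twin of the seat's pre-landing scratch: the SAME pair (U3ᴷ, v7c 2ᶜᴰ-text) that closes the aside K2⁷ by p613914 pays DEF-1's `RowsContAll` and (with K1⁷) K1⁸; the moduli
half of U3 pays K1 v7ᴿ's registered `stub_cont13` TEXT; the any-slack ∃-side producer applies with slack `1`; (ed.2, PORT-1 g4 for g3's T0″) A6–A8: the MASS-BAND road — U3ᴷ ⟹ U3ᴷ-lite feeds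
`rowsContAll_of_u3LiteK_cornerDriftPosK`, K1⁸ BY NAME from the ceiling-keyed mass-band producer, the generic lever at any height.  0 sorry.  Nothing of Bałaban asserted; YM mass gap NOT proved.
-/

noncomputable section

open scoped Matrix.Norms.L2Operator

namespace Summit.QuantumFields.YangMills.Cruxes.EndpointGivenBR13SepCoPH.Port5CornerRoadRowsApply

open Literature.MathematicalPhysics.QuantumFieldTheory.Balaban1983to89
open Literature.MathematicalPhysics.QuantumFieldTheory.Balaban1983to89.FlowStep
open Literature.MathematicalPhysics.QuantumFieldTheory.Balaban1983to89.DagBinding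
open Literature.MathematicalPhysics.QuantumFieldTheory.Balaban1983to89.T4Continuum (T4Family)
open Literature.MathematicalPhysics.QuantumFieldTheory.Balaban1983to89.T4CouplingMatching (ScaleShiftRate HistLipschitz)
open Literature.MathematicalPhysics.QuantumFieldTheory.Balaban1983to89.Beta.Drift (OneLoopDrift)
open Summit.QuantumFields.YangMills.Theorems.BalabanUVNodesK2NamedJetsRemAt (ScaleAnchor)
open Summit.QuantumFields.YangMills.Theorems.BalabanUVNodesK2V6Defs (Window13)
open Summit.QuantumFields.YangMills.Theorems.K1V6Defs (RecordS)
open Summit.QuantumFields.YangMills.Theorems.BalabanUVNodesK1R8RowsDefs (RowsContAll endpointGivenBR13SepCoPH_of_rowsContAll stabilityBAtRecordR13SepCoPH_of_runRows)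
open Summit.QuantumFields.YangMills.Theses.BalabanUVNodes (EndpointGivenBR13SepCoPH StabilityBAtRecordR13SepCoPH StabilityBRunRowsAtRecordR13SepCoPH)
open Summit.QuantumFields.YangMills.Theorems.BalabanUVNodesK2CornerDriftOfU3 (EndpointGivenBR13SepCoPH_of_u3K_cornerDriftPosK)
open Summit.QuantumFields.YangMills.Theorems.BalabanUVNodesK2CornerRoadRows
open Summit.QuantumFields.YangMills.Theorems.BalabanUVNodesK2CornerRoadRowsMassBand
open Summit.QuantumFields.YangMills.Theorems.BalabanUVNodesK2NamedJetsRemAt (ConstRemainder)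
open Summit.QuantumFields.YangMills.Theorems.K1V6Defs (Inhabited13)

variable {F : T4Family}
/-- (A1) the SAME pair (hU3, hCD) that closes the aside K2⁷ by p613914 pays `RowsContAll` (this file) — identical binder texts. -/
example
    (hU3 : ∀ (F : T4Family) (θ : Node00.Stage13HParams F 2) (hP : θ.Provisos₁₃SepCoPH F 2), (θ.ZhUnity F 2 ∧ θ.SlotsNondegenerate₁₃ F 2) → θ.Admissible F 2 →
      B16.EndStatementBPrinted (Node00.datumOfRecord₁₃SepCoPH F 2 θ hP).C → Window13 F θ hP →
      ∃ (c C ρ : ℝ) (Λ : ℕ → ℕ → ℝ), 0 ≤ c ∧ 0 < ρ ∧ ρ < 1 ∧ ScaleShiftRate c ρ θ.γ (Node00.datumOfRecord₁₃SepCoPH F 2 θ hP).βfun ∧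
        HistLipschitz Λ θ.γ (Node00.datumOfRecord₁₃SepCoPH F 2 θ hP).βfun ∧ T4CouplingMatching.FadingMemory C ρ Λ)
    (hCD : ∀ (F : T4Family) (θ : Node00.Stage13HParams F 2) (hP : θ.Provisos₁₃SepCoPH F 2), (θ.ZhUnity F 2 ∧ θ.SlotsNondegenerate₁₃ F 2) → θ.Admissible F 2 →
      B16.EndStatementBPrinted (Node00.datumOfRecord₁₃SepCoPH F 2 θ hP).C → Window13 F θ hP →
      ∃ (b : ℕ → ℝ) (s A : ℝ), ScaleAnchor (Node00.datumOfRecord₁₃SepCoPH F 2 θ hP).βfun b ∧ 0 < s ∧ OneLoopDrift s A b) :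
    EndpointGivenBR13SepCoPH ∧ RowsContAll :=
  ⟨EndpointGivenBR13SepCoPH_of_u3K_cornerDriftPosK hU3 hCD, rowsContAll_of_u3K_cornerDriftPosK hU3 hCD⟩

/-- (A2) … and the aside K2⁷ is RE-DERIVED through DEF-1's rows bridge (second road to the same decl; sanity). -/
example
    (hU3 : ∀ (F : T4Family) (θ : Node00.Stage13HParams F 2) (hP : θ.Provisos₁₃SepCoPH F 2), (θ.ZhUnity F 2 ∧ θ.SlotsNondegenerate₁₃ F 2) → θ.Admissible F 2 →
      B16.EndStatementBPrinted (Node00.datumOfRecord₁₃SepCoPH F 2 θ hP).C → Window13 F θ hP →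
      ∃ (c C ρ : ℝ) (Λ : ℕ → ℕ → ℝ), 0 ≤ c ∧ 0 < ρ ∧ ρ < 1 ∧ ScaleShiftRate c ρ θ.γ (Node00.datumOfRecord₁₃SepCoPH F 2 θ hP).βfun ∧
        HistLipschitz Λ θ.γ (Node00.datumOfRecord₁₃SepCoPH F 2 θ hP).βfun ∧ T4CouplingMatching.FadingMemory C ρ Λ)
    (hCD : ∀ (F : T4Family) (θ : Node00.Stage13HParams F 2) (hP : θ.Provisos₁₃SepCoPH F 2), (θ.ZhUnity F 2 ∧ θ.SlotsNondegenerate₁₃ F 2) → θ.Admissible F 2 →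
      B16.EndStatementBPrinted (Node00.datumOfRecord₁₃SepCoPH F 2 θ hP).C → Window13 F θ hP →
      ∃ (b : ℕ → ℝ) (s A : ℝ), ScaleAnchor (Node00.datumOfRecord₁₃SepCoPH F 2 θ hP).βfun b ∧ 0 < s ∧ OneLoopDrift s A b) :
    EndpointGivenBR13SepCoPH :=
  endpointGivenBR13SepCoPH_of_rowsContAll (rowsContAll_of_u3K_cornerDriftPosK hU3 hCD)

/-- (A3) K1⁸ ⟹ K1⁷ round trip: the K1⁸ concluded from (K1⁷, U3ᴷ, 2ᶜᴰ) gives back K1⁷ (DEF-1's drop-the-rows bridge). -/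
example (h1 : StabilityBAtRecordR13SepCoPH)
    (hU3 : ∀ (F : T4Family) (θ : Node00.Stage13HParams F 2) (hP : θ.Provisos₁₃SepCoPH F 2), (θ.ZhUnity F 2 ∧ θ.SlotsNondegenerate₁₃ F 2) → θ.Admissible F 2 →
      B16.EndStatementBPrinted (Node00.datumOfRecord₁₃SepCoPH F 2 θ hP).C → Window13 F θ hP →
      ∃ (c C ρ : ℝ) (Λ : ℕ → ℕ → ℝ), 0 ≤ c ∧ 0 < ρ ∧ ρ < 1 ∧ ScaleShiftRate c ρ θ.γ (Node00.datumOfRecord₁₃SepCoPH F 2 θ hP).βfun ∧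
        HistLipschitz Λ θ.γ (Node00.datumOfRecord₁₃SepCoPH F 2 θ hP).βfun ∧ T4CouplingMatching.FadingMemory C ρ Λ)
    (hCD : ∀ (F : T4Family) (θ : Node00.Stage13HParams F 2) (hP : θ.Provisos₁₃SepCoPH F 2), (θ.ZhUnity F 2 ∧ θ.SlotsNondegenerate₁₃ F 2) → θ.Admissible F 2 →
      B16.EndStatementBPrinted (Node00.datumOfRecord₁₃SepCoPH F 2 θ hP).C → Window13 F θ hP →
      ∃ (b : ℕ → ℝ) (s A : ℝ), ScaleAnchor (Node00.datumOfRecord₁₃SepCoPH F 2 θ hP).βfun b ∧ 0 < s ∧ OneLoopDrift s A b) :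
    StabilityBAtRecordR13SepCoPH :=
  stabilityBAtRecordR13SepCoPH_of_runRows (stabilityBRunRowsAtRecordR13SepCoPH_of_k17_u3K_cornerDriftPosK h1 hU3 hCD)

/-- (A4) the stub-3 TEXT concluded is LITERALLY K1 v7ᴿ's registered `stub_cont13` signature over the tree names (`Iff.rfl`-level: same constants). -/
example (hMod : ∀ (F : T4Family) (θ : Node00.Stage13HParams F 2) (hP : θ.Provisos₁₃SepCoPH F 2), θ.Admissible F 2 →
      ∃ Λ : ℕ → ℕ → ℝ, HistLipschitz Λ θ.γ (Node00.datumOfRecord₁₃SepCoPH F 2 θ hP).βfun) :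
    ∀ F : T4Family, Summit.QuantumFields.YangMills.Theorems.K1V6Defs.RunRowsAtSomeRecord13PWS F →
      Summit.QuantumFields.YangMills.Theorems.K1V7RDefs.RunRowsContAtSomeRecord13PWS F :=
  stub_cont13Text_of_histModuliK hMod

/-- (A5) NEGATIVE-CONTROL SHAPE: the any-slack producer's match is STRICT; with `s + 2A = w.βup` the theorem does not apply (no positive radius) — recorded as a comment, the positive
instance: slack `1`. -/
example (θ : Node00.Stage13HParams F 2) (h : θ.Provisos₁₃SepCoPH F 2) (w : WorldP)
    (hU : θ.ZhUnity F 2 ∧ θ.SlotsNondegenerate₁₃ F 2) (hθ : θ.Admissible F 2) (hR : RecordS F θ h w) (hnodes : ∀ P : B12.RunParams, Nodes (leavesP w P))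
    {c ρ : ℝ} {Λ : ℕ → ℕ → ℝ} (hρ0 : 0 ≤ ρ) (hρ1 : ρ < 1)
    (hss : ScaleShiftRate c ρ θ.γ (Node00.datumOfRecord₁₃SepCoPH F 2 θ h).βfun) (hL : HistLipschitz Λ θ.γ (Node00.datumOfRecord₁₃SepCoPH F 2 θ h).βfun)
    {b : ℕ → ℝ} {s A : ℝ} (hb : ScaleAnchor (Node00.datumOfRecord₁₃SepCoPH F 2 θ h).βfun b) (hs : 0 < s) (hdrift : OneLoopDrift s A b)
    (hmatch : s + 2 * A + 1 = w.βup) : Summit.QuantumFields.YangMills.Theorems.K1V7RDefs.RunRowsContAtSomeRecord13PWS F :=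
  runRowsContAtSomeRecord13PWS_of_rung1At_letters_cornerDrift_lt θ h w hU hθ hR hnodes hρ0 hρ1 hss hL hb hs hdrift (by linarith)

/-- (A6, ed.2) THE MASS-BAND ROAD SUBSUMES THE U3ᴷ ROAD: the same pair (hU3, hCD) pays `RowsContAll` through `u3LiteK_of_u3K` + `rowsContAll_of_u3LiteK_cornerDriftPosK` (N17-free proof). -/
example
    (hU3 : ∀ (F : T4Family) (θ : Node00.Stage13HParams F 2) (hP : θ.Provisos₁₃SepCoPH F 2), (θ.ZhUnity F 2 ∧ θ.SlotsNondegenerate₁₃ F 2) → θ.Admissible F 2 →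
      B16.EndStatementBPrinted (Node00.datumOfRecord₁₃SepCoPH F 2 θ hP).C → Window13 F θ hP →
      ∃ (c C ρ : ℝ) (Λ : ℕ → ℕ → ℝ), 0 ≤ c ∧ 0 < ρ ∧ ρ < 1 ∧ ScaleShiftRate c ρ θ.γ (Node00.datumOfRecord₁₃SepCoPH F 2 θ hP).βfun ∧
        HistLipschitz Λ θ.γ (Node00.datumOfRecord₁₃SepCoPH F 2 θ hP).βfun ∧ T4CouplingMatching.FadingMemory C ρ Λ)
    (hCD : ∀ (F : T4Family) (θ : Node00.Stage13HParams F 2) (hP : θ.Provisos₁₃SepCoPH F 2), (θ.ZhUnity F 2 ∧ θ.SlotsNondegenerate₁₃ F 2) → θ.Admissible F 2 →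
      B16.EndStatementBPrinted (Node00.datumOfRecord₁₃SepCoPH F 2 θ hP).C → Window13 F θ hP →
      ∃ (b : ℕ → ℝ) (s A : ℝ), ScaleAnchor (Node00.datumOfRecord₁₃SepCoPH F 2 θ hP).βfun b ∧ 0 < s ∧ OneLoopDrift s A b) : RowsContAll :=
  rowsContAll_of_u3LiteK_cornerDriftPosK (u3LiteK_of_u3K hU3) hCD

/-- (A7, ed.2) K1⁸ BY NAME, N17-free and match-free: the ceiling-keyed mass-band producer's conclusion IS the route decl (type ascription). -/
example
    (hprod : ∀ F : T4Family, Inhabited13 F →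
      ∃ (θ : Node00.Stage13HParams F 2) (h : θ.Provisos₁₃SepCoPH F 2), (θ.ZhUnity F 2 ∧ θ.SlotsNondegenerate₁₃ F 2) ∧ θ.Admissible F 2 ∧
        (∀ c : ℝ, ∃ w : WorldP, c ≤ w.βup ∧ RecordS F θ h w ∧ ∀ P : B12.RunParams, Nodes (leavesP w P)) ∧
        (∃ (Λ : ℕ → ℕ → ℝ) (M : ℝ), HistLipschitz Λ θ.γ (Node00.datumOfRecord₁₃SepCoPH F 2 θ h).βfun ∧ ∀ k, ∑ i : Fin (k + 1), |Λ k i| ≤ M) ∧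
        ∃ (b : ℕ → ℝ) (s A : ℝ), ScaleAnchor (Node00.datumOfRecord₁₃SepCoPH F 2 θ h).βfun b ∧ 0 < s ∧ OneLoopDrift s A b) :
    Summit.QuantumFields.YangMills.Theses.BalabanUVNodes.StabilityBRunRowsAtRecordR13SepCoPH :=
  stabilityBRunRowsAtRecordR13SepCoPH_of_ceilingKeyedRung1WithMassBandCornerLetters hprod

/-- (A8, ed.2) the generic lever at ANY height `s > 0` and any `HBeta`: moduli with bounded mass + anchor ⟹ DEF-1's `ConstRemainder` on some level `≤ γ`. -/
example {β : FlowStep.HBeta} {b : ℕ → ℝ} {Λ : ℕ → ℕ → ℝ} {γ M : ℝ} (hγ : 0 < γ) (hL : HistLipschitz Λ γ β)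
    (hM : ∀ k, ∑ i : Fin (k + 1), |Λ k i| ≤ M) (hb : ScaleAnchor β b) : ∃ γs : ℝ, 0 < γs ∧ γs ≤ γ ∧ ConstRemainder β b 1 γs :=
  constRemainder_of_histLipschitz_massBound_scaleAnchor hγ hL hM hb one_pos

end Summit.QuantumFields.YangMills.Cruxes.EndpointGivenBR13SepCoPH.Port5CornerRoadRowsApply

end
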